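import Summits.ResolutionOfSingularities.ResolutionOfSingularities.Theses.UniversalCells
import Summits.ResolutionOfSingularities.ResolutionOfSingularities.Theorems.WeightedInvariantDescentReducedToIntegral
import Summits.ResolutionOfSingularities.ResolutionOfSingularities.Theorems.UniversalCellsPrimeFieldToPerfectStubTower
import Summits.ResolutionOfSingularities.ResolutionOfSingularities.Theorems.UniversalCellsPrimeFieldToPerfectStubSeparableDescent
import Summits.ResolutionOfSingularities.ResolutionOfSingularities.Theorems.UniversalCellsPrimeFieldToPerfectStubClimbAlgebraic
import Summits.ResolutionOfSingularities.ResolutionOfSingularities.Theorems.UniversalCellsPrimeFieldToPerfectClimbOfRatFuncPerf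
import Mathlib.FieldTheory.RatFunc.AsPolynomial
import HarnessLib

/-!
# Crux `PrimeFieldToPerfect` (stmt-ResolutionOfSingularities-15233) — line `birth`, RESHAPE 4

Lead c1 prover-line-stmt-ResolutionOfSingularities-15233-c1-0, 2026-08-17 (continuing lead -0's RESHAPE 2).
Lead c2 prover-line-stmt-ResolutionOfSingularities-15233-c2-0, 2026-08-17: skeleton ADOPTED UNCHANGED (RESHAPE 4,
one open registered stub `stub_climbRatFuncPerf`); the composition is also landed importably as
`Theorems.PrimeFieldToPerfect.primeFieldToPerfect_of_climbRatFuncPerf` (Theorems/UniversalCellsPrimeFieldToPerfectOfClimbRatFuncPerf.lean).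
Lead c3 prover-line-stmt-ResolutionOfSingularities-15233-c3-0, 2026-08-17: skeleton ADOPTED UNCHANGED (RESHAPE 4, one open
registered stub `stub_climbRatFuncPerf`; the four payload lines of seat c3 are foreign to this crux, see PICKED.md);
kernel notes of c3 (closed fibres / one smooth fibre suffices / simultaneous resolution after Frobenius base change):
`Cruxes/PrimeFieldToPerfect/KERNEL-c3.md`.

**RESHAPE 4 (this revision).** The transcendental kernel of RESHAPE 3 is normalised to its live
case: ONE registered stub `stub_climbRatFuncPerf` — resolution over a perfect `M` of characteristic
`p` (all dimensions) ⇒ resolution over every perfect `L` purely inseparable over `RatFunc M`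
(`L ≅ M(t)^{perf}`). The glue `stub_climbTranscendental_of_ratFuncPerf : Sig.stub_climbRatFuncPerf →
Sig.stub_climbTranscendental` is PROVED (`L₀ := perfectClosure M⟮t⟯ L` is perfect and purely
inseparable over `M⟮t⟯ ≅ RatFunc M` by `RatFunc.algEquivOfTranscendental`; `L/L₀` is algebraic, so
the LANDED `stub_climbAlgebraic` p154863 finishes), and the skeleton theorem is
`PrimeFieldToPerfect_of : Sig.stub_climbRatFuncPerf → PrimeFieldToPerfect`.

**RESHAPE 3.** The one open registered stub of RESHAPE 2, `stub_climb` (the transfer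
kernel `Climb p`: a perfect constant field `M` with resolution in all dimensions, a perfect `L ⊇ M`
algebraic over `M(t)` ⇒ resolution over `L`), is split BY CASES ON `t` at the skeleton level into
* `stub_climbAlgebraic` — the DEGENERATE case, `L` algebraic over `M` (TRUE, size M: finite-type
  descent of `X / L` to a finitely generated level `M(s) ⊆ L`, which is FINITE over the perfect `M`,
  hence perfect; resolve `X₀ ×_{K₀} M(s)` over `M` by the hypothesis (it is of finite type over `M`
  through the finite `Spec M(s) → Spec M`); regular of finite type over the perfect `M(s)` ⇒ smooth ⇒
  its base change along `M(s) → L` is regular, proper, birational — the landed robust-model lemma).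
  Stated with the minimal true hypotheses (no prime, no characteristic, `L` not assumed perfect);
* `stub_climbTranscendental` — THE OPEN KERNEL, now literally "ONE TRANSCENDENTAL": the registered
  `stub_climb` signature with `Transcendental M t` added (live case `L = M(t)^{perf}`);
and `stub_climb_of_cases : Sig.stub_climbAlgebraic → Sig.stub_climbTranscendental → Sig.stub_climb`
is PROVED (excluded middle on `IsAlgebraic M t`; in the algebraic case `M(t)/M` is finite and `L/M(t)`
is algebraic by hypothesis, so `L/M` is algebraic by transitivity). `stub_climbAlgebraic` is
LANDED (p154863, `Theorems/UniversalCellsPrimeFieldToPerfectStubClimbAlgebraic.lean`, used below by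
its tree name as `stub_climbAlgebraic_holds`). RESHAPE 2's composition is kept as
`perfectRes_of_climb : Sig.stub_climb → ∀ p, p.Prime → IntegralResOver (ZMod p) → PerfectRes p`
and the skeleton theorem is now `PrimeFieldToPerfect_of : Sig.stub_climbTranscendental →
PrimeFieldToPerfect`, so `PrimeFieldToPerfect_proof` closes the crux modulo exactly ONE stub, the
transcendental kernel.

**State (inherited from RESHAPE 2).** The crux ("for a prime `p`: resolution of all INTEGRAL separated finite-type schemes over
`Spec (ZMod p)` ⇒ resolution of all REDUCED separated finite-type schemes over every PERFECT field of
characteristic `p`") is kernel-checked EQUAL to ONE registered open stub, `stub_climb` — the open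
transfer kernel in the atomic normal form found by the crux strategist
(planner-cstrat-stmt-ResolutionOfSingularities-15233-b1-0, line `frobenius-root-climb`, adopted here as the
cut of the node `PerfectClosureRes p`):

    PrimeFieldToPerfect_of : Sig.stub_climb → PrimeFieldToPerfect   (PROVED; uses the LANDED stub_tower p152147,
        stub_separableDescent p149298 and descentReducedToIntegral_proof stmt-0551 by their tree names)

Everything else this line produced is LANDED under `Theorems/UniversalCellsPrimeFieldToPerfect*.lean`
(namespace `…Theorems.PrimeFieldToPerfect`): `stub_spreadOut` (p149455: 𝔽_p ⇒ finitely generated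
fields), `stub_limitDescent` (p148751: smooth twisted model ⇒ perfect closures), `stub_separableDescent`
(p149298: perfect closures ⇒ all perfect fields), `smoothTwist_of_finite` (p148949: the kernel over finite
ground fields), `stub_tower` (p152147: prime field + climb ⇒ perfect closures of f.g. fields).

**The two normal forms of the kernel** (equivalent modulo the landed stubs and EGA IV₃ §8 descent; see the
crux workfiles `KERNEL.md` (lead) and `STRATEGY-CENSUS.md` (strategist)):
* `Climb p` (REGISTERED here as `stub_climb`): for a PERFECT `M` of characteristic `p` with resolution of
  all integral separated finite-type `M`-schemes and a perfect `L ⊇ M` containing `t` with `L` algebraic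
  over `M(t)`, resolution holds over `L` — one transcendental at a time over a perfect constant field.
* `SmoothTwist p` (RESHAPE 1's `stub_smoothTwist`, kept below as a definition and as the importable entry
  point `Theorems.PrimeFieldToPerfect.primeFieldToPerfect_of_smoothTwist`): over a finitely generated `K`,
  some FINITE purely inseparable twist `X₀ ×_K K'` of a variety integral over `K^{perf}` has a proper
  birational model SMOOTH over `K'`.
Why open (both): at every finite level the hypothesis yields only REGULAR models and regular ⇏ smooth
(`Literature.Barriers.ResolutionOfSingularities.RegularNotGeometricallyRegular`); blind
"resolve – extract a p-th root – re-resolve" does not terminate in general (an adversarial resolution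
re-creates inseparable closed points at every level, STRATEGY-CENSUS §Negation N2), so a proof must
SELECT resolutions; no argument in print beyond curves (Tate genus drop) and dimension ≤ 3
(Cossart–Piltant, by an intrinsic invariant, no climb). Hu (arXiv:2507.21400, p. 9) claims the transfer
with the proof deferred to an unpublished Part II.

History: birth skeleton (planner, 3 stubs) → RESHAPE 1 (lead: `stub_perfectClosure` = `stub_limitDescent ∘
stub_smoothTwist`, 4 stubs, unfolded registered signatures; 3 stubs + finite case landed in wave 1) →
RESHAPE 2 (this file: the strategist's cut `stub_tower ∘ stub_climb` of the same node, `stub_tower`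
landed in wave 2; `stub_spreadOut`/`stub_limitDescent` are no longer on the composition path but stay
as landed supports of the SmoothTwist entry point). Registered `stub_*` signatures are stated with every
file-local predicate UNFOLDED (stub files under `Theorems/` repeat the header verbatim); the `Sig.stub_*`
defs and the compositions keep the folded, readable form (definitionally equal).

Disproof used: none on file for this crux (no `Disproof.lean`; refuter rattack-15233-0 verdict SURVIVES,
S → C proved in its CruxAttack.lean). Barrier witnesses checked: no stub base-changes a resolution along an
inseparable extension (`InseparableBaseChangeResolution`, `RegularNotGeometricallyRegular` bite only
ATTEMPTS on the kernel, recorded in KERNEL.md §3).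
-/

noncomputable section

-- single-problem summit: the doubled namespace component `ResolutionOfSingularities` is forced
set_option linter.dupNamespace false

open CategoryTheory CategoryTheory.Limits AlgebraicGeometry Literature.AlgebraicGeometry.Resolution
open Summit.ResolutionOfSingularities.ResolutionOfSingularities.Theses.UniversalCells (PrimeFieldToPerfect)

namespace Summit.ResolutionOfSingularities.ResolutionOfSingularities.Cruxes.PrimeFieldToPerfect.Lines.Birth

/-! ## The predicates of the cut -/

/-- **Resolution of integral separated schemes of finite type over `Spec R`** — for `R = ZMod p`
verbatim the hypothesis of the crux `UniversalCells.PrimeFieldToPerfect`; for a field `R = K`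
verbatim the hypothesis of the landed `WeightedInvariant.DescentReducedToIntegral`.
[cite: Kollar2007, Ch. 3 (the problem in char p)] -/
def IntegralResOver (R : Type) [CommRing R] : Prop :=
  ∀ (X : Scheme.{0}) (f : X ⟶ Spec (.of R)), IsSeparated f → LocallyOfFiniteType f →
    QuasiCompact f → IsIntegral X → Scheme.HasResolution X

/-- **`K` is a finitely generated field** (finitely generated as a field over its prime field):
some finite set generates `K` as a subfield. For `char K = p` these are exactly the function
fields `Frac A` of integral `𝔽_p`-algebras `A` of finite type (`Subfield.mem_closure_iff`).
[folklore] -/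
def FieldFG (K : Type) [Field K] : Prop :=
  ∃ s : Finset K, Subfield.closure (s : Set K) = ⊤

/-- **Resolution over all finitely generated fields of characteristic `p`** (integral separated
schemes of finite type). [cite: EGAIV3, Thm. 8.8.2 (ii)] -/
def FGRes (p : ℕ) : Prop :=
  ∀ (K : Type) [Field K] [CharP K p], FieldFG K → IntegralResOver K

/-- **Resolution over the perfect closures of finitely generated fields of characteristic `p`**:
for every finitely generated `K` of characteristic `p` and every PERFECT field `L` purely
inseparable (and algebraic) over `K` — i.e. `L ≅ K^{perf}` — integral separated `L`-schemes of
finite type are resolvable. [cite: Kollar2007, 1.19 (Curves over nonperfect fields)] -/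
def PerfectClosureRes (p : ℕ) : Prop :=
  ∀ (K : Type) [Field K] [CharP K p], FieldFG K →
    ∀ (L : Type) [Field L] [PerfectField L] [Algebra K L] [IsPurelyInseparable K L],
      IntegralResOver L

/-- **Resolution of integral separated schemes of finite type over every perfect field of
characteristic `p`** — the integral case of the crux's conclusion. [folklore] -/
def PerfectRes (p : ℕ) : Prop :=
  ∀ (k : Type) [Field k] [CharP k p] [PerfectField k], IntegralResOver k

/-! ## Sanity (proved): stub 3 loses nothing — its hypothesis is a special case of its
conclusion (a perfect purely inseparable extension of a char-`p` field is a perfect field of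
characteristic `p`), so `stub_separableDescent` is an EQUIVALENCE `PerfectClosureRes p ↔
PerfectRes p` whose converse is this one-liner; the content is the direction stated as the stub. -/

/-- A perfect purely inseparable extension `L` of a finitely generated field `K` of
characteristic `p` is a perfect field of characteristic `p`, so resolution over all perfect fields
of characteristic `p` gives it over `L`. [folklore] -/
theorem perfectClosureRes_of_perfectRes {p : ℕ} (h : PerfectRes p) : PerfectClosureRes p := by
  intro K _ _ _ L _ _ _ _
  haveI : CharP L p := charP_of_injective_algebraMap (algebraMap K L).injective p
  exact h L

/-- **`SmoothTwist p` — some finite purely inseparable twist has a SMOOTH proper birational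
model.** For every finitely generated field `K` of characteristic `p` and every separated
`K`-scheme of finite type `X₀` which becomes INTEGRAL over some perfect purely inseparable
extension `L ⊇ K` (i.e. over the perfect closure `K^{perf}`: `X₀` is integral, geometrically
reduced, and irreducible over `K^{perf}`), there are a FINITE purely inseparable extension `K'/K`
and a proper birational `π : Y → X₀ ×_K K'` whose source is SMOOTH over `K'` (equivalently, by
`K' ≅ K` along Frobenius: some Frobenius twist `X₀^{(p^m)}` has a smooth proper birational model
over `K`). This is the prover-facing form of the open kernel of the crux (grounder note on
stmt-ResolutionOfSingularities-15233): implied by resolution over `K^{perf}` (a resolution over the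
perfect `L` descends to a finite level, where regular-over-perfect = smooth descends to smooth) and
implying it (`stub_limitDescent`). Why it might fail: resolutions over `K` and its finite levels are
only REGULAR, and regular ⇏ smooth (`Literature.Barriers.ResolutionOfSingularities.
RegularNotGeometricallyRegular`: `y² = x^p − t`); no termination argument for twist-and-re-resolve
is in print. [cite: Kollar2007, 1.19 (Curves over nonperfect fields)] -/
def SmoothTwist (p : ℕ) : Prop :=
  ∀ (K : Type) [Field K] [CharP K p], FieldFG K →
    ∀ (X₀ : Scheme.{0}) (f₀ : X₀ ⟶ Spec (.of K)),
      IsSeparated f₀ → LocallyOfFiniteType f₀ → QuasiCompact f₀ →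
      (∃ (L : Type) (_ : Field L) (_ : PerfectField L) (_ : Algebra K L)
          (_ : IsPurelyInseparable K L),
          IsIntegral (pullback f₀ (Spec.map (CommRingCat.ofHom (algebraMap K L))))) →
      ∃ (K' : Type) (_ : Field K') (_ : Algebra K K') (_ : IsPurelyInseparable K K')
        (_ : Module.Finite K K') (Y : Scheme.{0})
        (π : Y ⟶ pullback f₀ (Spec.map (CommRingCat.ofHom (algebraMap K K')))),
        IsProper π ∧ IsBirational π ∧
          Smooth (π ≫ pullback.snd f₀ (Spec.map (CommRingCat.ofHom (algebraMap K K'))))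

/-- **`Climb p` — THE OPEN KERNEL in atomic normal form (crux strategist, line
`frobenius-root-climb`): one transcendental over a perfect constant field.** For every perfect field
`M` of characteristic `p` with `IntegralResOver M` (all dimensions) and every perfect field `L` of
characteristic `p` over `M` containing an element `t` with `L` algebraic over `M(t)` (live case
`L = M(t)^{perf}`), `IntegralResOver L`. Implied by the summit; true unconditionally for `dim ≤ 3`
(Cossart–Piltant); for curves it is normalisation and the Frobenius tower terminates by Tate's genus
drop. Why it might fail / why open: at each finite level `M(t^{p^{-n}}) ≅ M(t)` only REGULAR models are
supplied, regular ⇏ smooth, and root-extraction + re-resolution has no termination argument in print.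
[cite: arXiv:1708.04268, Thm 1.1 and §2.4 (Patakfalvi–Waldron)] -/
def Climb (p : ℕ) : Prop :=
  ∀ (M : Type) [Field M] [CharP M p] [PerfectField M], IntegralResOver M →
    ∀ (L : Type) [Field L] [CharP L p] [PerfectField L] [Algebra M L] (t : L),
      Algebra.IsAlgebraic (IntermediateField.adjoin M ({t} : Set L)) L → IntegralResOver L

/-- Sanity: the kernel's conclusion is a special case of the crux's — `Climb p` follows from
`PerfectRes p` by forgetting `M` and `t` (the cut loses nothing). [folklore] -/
theorem climb_of_perfectRes {p : ℕ} (h : PerfectRes p) : Climb p := by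
  intro M _ _ _ _ L _ _ _ _ _ _
  exact h L

/-! ## The stub STATEMENTS by name (`Sig.stub_<name>`). Only the OPEN stub is a hypothesis of the
composition `PrimeFieldToPerfect_of`; the landed stubs are used inside its proof by their tree names. -/

/-- Statement of `stub_climb`: the kernel in atomic normal form, prime by prime (RESHAPE 2; in
RESHAPE 3 it is DERIVED from the two registered stubs by `stub_climb_of_cases`).
[cite: arXiv:1708.04268, Thm 1.1 and §2.4 (Patakfalvi–Waldron)] -/
def Sig.stub_climb : Prop :=
  ∀ p : ℕ, p.Prime → Climb p

/-- Statement of `stub_climbAlgebraic` (RESHAPE 3, registered): the degenerate case of the climb —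
resolution over a perfect `M` gives resolution over every ALGEBRAIC extension `L` of `M`.
[cite: Liu2002, Prop. 3.2.7 and Cor. 4.3.33] -/
def Sig.stub_climbAlgebraic : Prop :=
  ∀ (M : Type) [Field M] [PerfectField M], IntegralResOver M →
    ∀ (L : Type) [Field L] [Algebra M L] [Algebra.IsAlgebraic M L], IntegralResOver L

/-- Statement of `stub_climbTranscendental` (RESHAPE 3, registered): THE OPEN KERNEL — `Climb p`
with `t` transcendental over `M` (live case `L = M(t)^{perf}`).
[cite: arXiv:1708.04268, Thm 1.1 and §2.4 (Patakfalvi–Waldron)] -/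
def Sig.stub_climbTranscendental : Prop :=
  ∀ p : ℕ, p.Prime → ∀ (M : Type) [Field M] [CharP M p] [PerfectField M], IntegralResOver M →
    ∀ (L : Type) [Field L] [CharP L p] [PerfectField L] [Algebra M L] (t : L),
      Transcendental M t →
      Algebra.IsAlgebraic (IntermediateField.adjoin M ({t} : Set L)) L → IntegralResOver L

/-- Statement of `stub_climbRatFuncPerf` (RESHAPE 4, registered): THE OPEN KERNEL in its sharpest
normal form — resolution over a perfect `M` of characteristic `p` (all dimensions) gives resolution
over the PERFECT CLOSURE OF THE RATIONAL FUNCTION FIELD `RatFunc M` (any perfect `L` purely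
inseparable over `RatFunc M`, i.e. `L ≅ (RatFunc M)^{perf}`).
[cite: arXiv:1708.04268, Thm 1.1 and §2.4 (Patakfalvi–Waldron)] -/
def Sig.stub_climbRatFuncPerf : Prop :=
  ∀ p : ℕ, p.Prime → ∀ (M : Type) [Field M] [CharP M p] [PerfectField M], IntegralResOver M →
    ∀ (L : Type) [Field L] [PerfectField L] [Algebra (RatFunc M) L]
      [IsPurelyInseparable (RatFunc M) L], IntegralResOver L

/-- Statement of the ALTERNATIVE kernel entry (RESHAPE 1, not registered any more; importable as
`Theorems.PrimeFieldToPerfect.primeFieldToPerfect_of_smoothTwist` together with the landed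
`stub_spreadOut`, `stub_limitDescent`, `stub_separableDescent`). [cite: Kollar2007, 1.19] -/
def Sig.stub_smoothTwist : Prop :=
  ∀ p : ℕ, p.Prime → IntegralResOver (ZMod p) → FGRes p → SmoothTwist p

/-! ## The stubs (registered signatures: every file-local predicate unfolded) -/

/-- **LANDED (p154863) — the degenerate case of the climb: algebraic extensions of a perfect
field.** `M` perfect with resolution of all integral separated finite-type `M`-schemes, `L` an
ALGEBRAIC extension field of `M` ⇒ resolution of all integral separated finite-type `L`-schemes:
the registered stub `stub_climbAlgebraic`, proved in
`Theorems/UniversalCellsPrimeFieldToPerfectStubClimbAlgebraic.lean` (finite-type descent of `X`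
to `M(s) ⊆ L`, FINITE over the perfect `M` hence perfect; resolve over `M`; regular over perfect ⇒
smooth; base change along `M(s) → L`) and used here by its tree name.
[cite: Liu2002, Prop. 3.2.7 and Cor. 4.3.33] -/
theorem stub_climbAlgebraic_holds : Sig.stub_climbAlgebraic :=
  fun M _ _ hM L _ _ _ X f hs hl hq hX =>
    _root_.Summit.ResolutionOfSingularities.ResolutionOfSingularities.Theorems.PrimeFieldToPerfect.stub_climbAlgebraic
      M hM L X f hs hl hq hX

/-- **STUB (THE OPEN KERNEL — the perfect closure of the rational function field; open-problem
sized; RESHAPE 4).** `M` perfect of characteristic `p` with resolution of all integral separated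
finite-type `M`-schemes, `L` perfect and purely inseparable over `RatFunc M` (i.e.
`L ≅ M(t)^{perf} = M(t^{1/p^∞})`) ⇒ resolution of all integral separated finite-type `L`-schemes.
This is the transfer kernel with every removable generality removed (`stub_climbAlgebraic`,
landed, moves resolution along algebraic extensions of perfect fields; the glue
`stub_climbTranscendental_of_ratFuncPerf` below is proved). Equivalent forms (KERNEL.md E1–E6,
KERNEL-c1.md F1–F6): some Frobenius twist `X₀^{(p^m)}` of a `K = M(t)`-model has a proper
birational model SMOOTH over `K`; a regular `K`-model `Y` is smooth iff `Y ⊗_K K^{1/p}` is regular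
(`[K : K^p] = p`, EGA 0_IV 22.5.8) iff the Jacobian ideal `J_t = T_{Y/M}(t)` is `(1)`; the
normalised twist is the quotient `Y/T_{Y/K}`, regular iff `J_t` is invertible, after which the
Jacobian ideal can only grow. Open: SELECTION of the re-resolutions where `J_t` is not invertible
(horizontal critical loci of codimension ≥ 2, from fibre dimension 2 on) + a terminating invariant
(curves: Tate; nothing in print beyond: Hu arXiv:2203.03842v4 §9.2 asserts this transfer with a
gap — a model "defined over 𝔽_p" is treated as of finite type over 𝔽_p — and arXiv:2507.21400
defers it to an unreleased Part II). What a proof may not do (Disproof.lean §4, KERNEL-c1 §2):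
level 0 (s1), normalise-only (s2), uniform level (s3), regular pullback / Néron–Popescu (s4),
blind ∀-choice iteration (s5), principalising `J_t` by blow-ups inside the critical locus (dead for
`p ≥ 5`). [cite: arXiv:1708.04268, Thm 1.1 and §2.4 (Patakfalvi–Waldron)] -/
theorem stub_climbRatFuncPerf (p : ℕ) (hp : p.Prime)
    (M : Type) [Field M] [CharP M p] [PerfectField M]
    (hM : ∀ (X : Scheme.{0}) (f : X ⟶ Spec (.of M)), IsSeparated f → LocallyOfFiniteType f →
      QuasiCompact f → IsIntegral X → Scheme.HasResolution X)
    (L : Type) [Field L] [PerfectField L] [Algebra (RatFunc M) L]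
    [IsPurelyInseparable (RatFunc M) L]
    (X : Scheme.{0}) (f : X ⟶ Spec (.of L)) (hs : IsSeparated f) (hl : LocallyOfFiniteType f)
    (hq : QuasiCompact f) (hX : IsIntegral X) : Scheme.HasResolution X := by
  sorry

/-- **RESHAPE 4 glue (PROVED): the perfect-closure-of-`RatFunc` kernel gives the transcendental
climb.** Given `t ∈ L` transcendental over `M` with `L` perfect and algebraic over `M⟮t⟯`: put
`L₀ := perfectClosure M⟮t⟯ L` — perfect (as `L` is), purely inseparable over `M⟮t⟯ ≅ RatFunc M`
(`RatFunc.algEquivOfTranscendental`), so `stub_climbRatFuncPerf` resolves over `L₀`; and `L` is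
algebraic over `M⟮t⟯ ⊆ L₀`, hence over the perfect `L₀`, so the LANDED `stub_climbAlgebraic`
(p154863) carries resolution from `L₀` to `L`. LANDED as
`Theorems.PrimeFieldToPerfect.climbTranscendental_of_climbRatFuncPerf` (p156288,
`Theorems/UniversalCellsPrimeFieldToPerfectClimbOfRatFuncPerf.lean`), used here by its tree name. [folklore] -/
theorem stub_climbTranscendental_of_ratFuncPerf (hR : Sig.stub_climbRatFuncPerf) :
    Sig.stub_climbTranscendental :=
  fun p hp M _ _ _ hM L _ _ _ _ t htr ht X f hs hl hq hX =>
    _root_.Summit.ResolutionOfSingularities.ResolutionOfSingularities.Theorems.PrimeFieldToPerfect.climbTranscendental_of_climbRatFuncPerf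
      (fun p hp M _ _ _ hM L _ _ _ _ X f hs hl hq hX => hR p hp M hM L X f hs hl hq hX)
      p hp M hM L t htr ht X f hs hl hq hX

/-- **The transcendental climb (RESHAPE 3's registered stub), now DERIVED (RESHAPE 4)** from the
sharper registered kernel `stub_climbRatFuncPerf` by `stub_climbTranscendental_of_ratFuncPerf`;
kept under its registered name and signature so that the RESHAPE-3 case split still composes.
[cite: arXiv:1708.04268, Thm 1.1 and §2.4 (Patakfalvi–Waldron)] -/
theorem stub_climbTranscendental (p : ℕ) (hp : p.Prime)
    (M : Type) [Field M] [CharP M p] [PerfectField M]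
    (hM : ∀ (X : Scheme.{0}) (f : X ⟶ Spec (.of M)), IsSeparated f → LocallyOfFiniteType f →
      QuasiCompact f → IsIntegral X → Scheme.HasResolution X)
    (L : Type) [Field L] [CharP L p] [PerfectField L] [Algebra M L] (t : L)
    (htr : Transcendental M t)
    (ht : Algebra.IsAlgebraic (IntermediateField.adjoin M ({t} : Set L)) L)
    (X : Scheme.{0}) (f : X ⟶ Spec (.of L)) (hs : IsSeparated f) (hl : LocallyOfFiniteType f)
    (hq : QuasiCompact f) (hX : IsIntegral X) : Scheme.HasResolution X :=
  stub_climbTranscendental_of_ratFuncPerf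
    (fun p hp M _ _ _ hM L _ _ _ _ X f hs hl hq hX =>
      stub_climbRatFuncPerf p hp M hM L X f hs hl hq hX)
    p hp M hM L t htr ht X f hs hl hq hX

/-- **The case split (RESHAPE 3, PROVED): the two registered stubs give RESHAPE 2's `stub_climb`.**
Excluded middle on `IsAlgebraic M t`: if `t` is transcendental this is `stub_climbTranscendental`
verbatim; if `t` is algebraic then `M(t)/M` is finite, `L/M(t)` is algebraic by hypothesis, so
`L/M` is algebraic (transitivity) and `stub_climbAlgebraic` applies (forgetting `p` and `t`).
[folklore] -/
theorem stub_climb_of_cases (hA : Sig.stub_climbAlgebraic) (hT : Sig.stub_climbTranscendental) :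
    Sig.stub_climb := by
  intro p hp M _ _ _ hM L _ _ _ _ t ht
  by_cases htr : Transcendental M t
  · exact hT p hp M hM L t htr ht
  · have halg : IsAlgebraic M t := by
      unfold Transcendental at htr
      exact Classical.not_not.mp htr
    haveI : FiniteDimensional M (IntermediateField.adjoin M ({t} : Set L)) :=
      IntermediateField.adjoin.finiteDimensional halg.isIntegral
    haveI : Algebra.IsAlgebraic M (IntermediateField.adjoin M ({t} : Set L)) :=
      Algebra.IsAlgebraic.of_finite M _
    haveI : Algebra.IsAlgebraic (IntermediateField.adjoin M ({t} : Set L)) L := ht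
    haveI : Algebra.IsAlgebraic M L :=
      Algebra.IsAlgebraic.trans M (IntermediateField.adjoin M ({t} : Set L)) L
    exact hA M hM L

/-! ## Landed pieces used by the composition (tree names, all `--supports stmt-…-15233`):
* `Theorems.PrimeFieldToPerfect.stub_tower` (p152147, Theorems/UniversalCellsPrimeFieldToPerfectStubTower.lean):
  registered signature `stub_tower` — prime field + climb ⇒ `PerfectClosureRes p` (unfolded);
* `Theorems.PrimeFieldToPerfect.stub_separableDescent` (p149298, …StubSeparableDescent.lean):
  registered signature `stub_separableDescent` — `PerfectClosureRes p → PerfectRes p` (unfolded);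
* `Theorems.descentReducedToIntegral_proof` (stmt-0551): reduced ⇒ integral over a fixed field.
(The RESHAPE-1 pieces `stub_spreadOut` p149455, `stub_limitDescent` p148751, `smoothTwist_of_finite`
p148949 serve the alternative entry `SmoothTwist`, not this composition.) -/

/-! ## The compositions (kernel-checked; no `sorry` in their own terms) -/

/-- `PerfectClosureRes p` from the prime-field hypothesis through the climb (hypothesis) and the
LANDED tower. [folklore] -/
theorem perfectClosureRes_of (h₁ : Sig.stub_climb) :
    ∀ p : ℕ, p.Prime → IntegralResOver (ZMod p) → PerfectClosureRes p :=
  fun p hp h₀ K _ _ hK L _ _ _ _ X f hs hl hq hX =>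
    _root_.Summit.ResolutionOfSingularities.ResolutionOfSingularities.Theorems.PrimeFieldToPerfect.stub_tower
      p hp h₀ (fun M _ _ _ hM L _ _ _ _ t ht => h₁ p hp M hM L t ht) K hK L X f hs hl hq hX

/-- `PerfectRes p` (the integral case of the crux's conclusion at `p`) from the prime-field
hypothesis and the climb: the landed tower gives `PerfectClosureRes p`, the landed separable descent
gives `PerfectRes p`. (RESHAPE 2's `PrimeFieldToPerfect_of`, re-concluded one step short of the crux
so that the FIRST theorem concluding the crux below has exactly the registered stubs as hypotheses.)
[folklore] -/
theorem perfectRes_of_climb (h₁ : Sig.stub_climb) :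
    ∀ p : ℕ, p.Prime → IntegralResOver (ZMod p) → PerfectRes p := by
  intro p hp hF k' _ _ _ Y g hs' hl' hq' hint
  have hPC : PerfectClosureRes p := perfectClosureRes_of h₁ p hp hF
  exact _root_.Summit.ResolutionOfSingularities.ResolutionOfSingularities.Theorems.PrimeFieldToPerfect.stub_separableDescent
    p hp (fun K _ _ hK L _ _ _ _ => hPC K hK L) k' Y g hs' hl' hq' hint

/-- **`PrimeFieldToPerfect` from the ONE open registered stub statement (RESHAPE 4)** — the
assembly, PROVED: the RatFunc-perfect-closure kernel (hypothesis) gives the transcendental climb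
(`stub_climbTranscendental_of_ratFuncPerf`, through the LANDED `stub_climbAlgebraic`); the case
split `stub_climb_of_cases` with the landed algebraic case gives the climb; fix `p`; the crux
hypothesis is `IntegralResOver (ZMod p)` on the nose; climb + landed tower + landed separable
descent give `PerfectRes p` (`perfectRes_of_climb`), and the landed reduced ⇒ integral reduction
(stmt-0551) finishes for reduced `X/k`. [folklore] -/
theorem PrimeFieldToPerfect_of : Sig.stub_climbRatFuncPerf → PrimeFieldToPerfect := by
  intro hR p hp hF k _ _ _ X f hs hl hq hr
  have hPerf : PerfectRes p :=
    perfectRes_of_climb (stub_climb_of_cases stub_climbAlgebraic_holds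
      (stub_climbTranscendental_of_ratFuncPerf hR)) p hp hF
  have hInt : ∀ (Y : Scheme.{0}) (g : Y ⟶ Spec (.of k)), IsSeparated g → LocallyOfFiniteType g →
      QuasiCompact g → IsIntegral Y → Scheme.HasResolution Y :=
    fun Y g hs' hl' hq' hint => hPerf k Y g hs' hl' hq' hint
  exact _root_.Summit.ResolutionOfSingularities.ResolutionOfSingularities.Theorems.descentReducedToIntegral_proof
    k hInt X f hs hl hq hr

/-- **The crux `PrimeFieldToPerfect`, assembled (RESHAPE 4)** — `PrimeFieldToPerfect_of` with the
one open registered stub plugged in (its unfolded signature is definitionally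
`Sig.stub_climbRatFuncPerf`); the only `sorry` in the closure is that kernel. -/
theorem PrimeFieldToPerfect_proof : PrimeFieldToPerfect :=
  PrimeFieldToPerfect_of
    (fun p hp M _ _ _ hM L _ _ _ _ X f hs hl hq hX =>
      stub_climbRatFuncPerf p hp M hM L X f hs hl hq hX)

end Summit.ResolutionOfSingularities.ResolutionOfSingularities.Cruxes.PrimeFieldToPerfect.Lines.Birth

end
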